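import Summits.NavierStokesRegularity.NavierStokesRegularity.Theorems.SoloRefuteSchatz2025WindJetIneq

/-!
# C171 `Schatz2025` — wind-jet refutation of the local face `Step_M1_local` — part 6/6 (file of record): `not_Step_M1_local`

Cell `ns-claims` (D-0090), row C171 `Schatz2025` (locator =
the LANDED skeleton `Literature.Claims.NS.Schatz2025`, text of record as cited in its module docstring). Records-grade ADDENDUM
object of ns-claims-refuter-5 g5 (chair 2026-08-27T18:19Z: records only; row #155 adjudicated at the consumed
head `Step_M1`). Target of the chain: the RECORDED local face
`Literature.Claims.NS.Schatz2025.Step_M1_local` (skeleton l.182; (M.1) p.42 l.2, l.36–38 «F(θr) ≤ κ F(r) + C θ³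
for every suitable weak solution on Q_r(z0)», constants `θ ∈ (0,1/8)`, `κ ∈ (0,1)`, `C ≥ 0` FIRST, then every
open region, every suitable weak solution, every centre and radius with `Q_{2r}(z0) ⊆ Q`).
Main theorem (last file of the chain): `Summit.NavierStokesRegularity.NavierStokesRegularity.Theorems.Schatz2025.not_Step_M1_local`.

THIS FILE (6/6, FILE OF RECORD): `not_Step_M1_local : ¬ Literature.Claims.NS.Schatz2025.Step_M1_local`.
Given the constants `(θ, κ, C)`, set `e = (1−κ)/16 ∈ (0, 1/16)`, `a = e¹⁰θ²`, `U = (1+e)/(ea)`,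
`M = 21600U²/e + C + 1`, and test the face on `Q = Q₂(0)`, `u = windJet M a U`, `p = 0`, `z = 0`, `r = 1`
(`Q₂(0) ⊆ Q₂(0)`): parts 2–4 give `Ffun θ ≥ LOW` and `Ffun 1 ≤ UP_A + UP_C` in `ℝ≥0∞`, part 5 gives
`κ(UP_A + UP_C) + Cθ³ < LOW` in `ℝ` — contradiction. MECHANISM (records): the recorded local face has NO
smallness gate and NO `r ≤ 1`; a thin codimension-2 heat column swept through `Q₁` by a fast constant wind
deposits its cubic mass `∫|u|³` at the SMALL scale `θ` in proportion to the time it spends inside `Q_θ`,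
which per unit of `C(r) = r⁻²∫_{Q_r}|u|³` beats the large scale by the factor `θ⁻²·θ²·(chord ratio) → 1⁻`
only after the `κ < 1` room is eaten by the explicit constants — hence the bookkeeping of part 5. The
consumed head `Step_M1` (global Leray–Hopf class, `r ≤ 1`, data at `t = 0`) is NOT touched by this object.
Std axioms only (`#print axioms` = propext, Classical.choice, Quot.sound on the combined development file).

WHAT THIS IS NOT: not a claim about NS regularity or blow-up; not a claim about any author beyond the typed
locator.
-/

-- lint debt (cell convention, SoloRefute files): the Theorems namespace repeats `NavierStokesRegularity`.
set_option linter.dupNamespace false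

noncomputable section

open Set Function MeasureTheory Filter TopologicalSpace Metric Real
open scoped Topology ContDiff ENNReal RealInnerProductSpace Laplacian

namespace Summit.NavierStokesRegularity.NavierStokesRegularity.Theorems.Schatz2025

open Literature.Analysis.FluidPDE Literature.Analysis.UnboundedOperators


/-- **Refutation of the recorded local face.** The statement `Step_M1_local` of the claims record
`Literature/Claims/NS/Schatz2025.lean` (the scale-free one-step Morrey improvement
`F(θr) ≤ κ F(r) + C θ³` demanded of EVERY suitable weak solution on EVERY open set, with
`θ < 1/8`, `κ < 1`) is false as typed. Witness, for given `(θ, κ, C)`: `Q = Q₂(0,0)`, `r = 1`,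
`z = (0,0)`, zero pressure, and the wind-jet `u(t,x) = U e₀ + M K_{t+a}(x_h − tU e₀) e_z` — a
classical (hence suitable) 2½-D solution on `Q₂`, a planar heat column born at time `−a < −4`
outside `Q₂` and swept through the origin by a Galilean wind. Its CKN triple concentrates on a
codimension-2 set, so `C(θ)/C(1) → 1` as the column thins while `A(1)`, the polynomial cross terms
and `Cθ³` are lower order in `M`; with `e = (1−κ)/16`, `a = e¹⁰θ²`, `U = (1+e)/(ea)`,
`M = 21600U²/e + C + 1` the inequality fails (`main_real_ineq`). [refuted-misstated] The intended
printed statement concerns the first step of a partial-regularity iteration under a smallness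
hypothesis on `F(r)`; a minimal repair adds `Ffun r z u p ≤ ENNReal.ofReal ε₀` as a hypothesis —
the witness has `F(1)` of order `M³ ≫ 1` and does not bite the repaired statement.
WHAT THIS IS NOT: not a claim about NS regularity or blow-up; not a claim about any author beyond
the typed locator. [folklore] -/
theorem not_Step_M1_local : ¬ Literature.Claims.NS.Schatz2025.Step_M1_local := by
  rintro ⟨θ, κ, C, hθ, hθ8, hκ0, hκ1, hC, h⟩
  obtain ⟨e, he⟩ : ∃ e : ℝ, e = (1 - κ) / 16 := ⟨_, rfl⟩
  obtain ⟨a, ha⟩ : ∃ a : ℝ, a = e ^ 10 * θ ^ 2 := ⟨_, rfl⟩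
  obtain ⟨U, hU⟩ : ∃ U : ℝ, U = (1 + e) / (e * a) := ⟨_, rfl⟩
  obtain ⟨M, hM⟩ : ∃ M : ℝ, M = 21600 * U ^ 2 / e + C + 1 := ⟨_, rfl⟩
  have he0 : 0 < e := by rw [he]; linarith
  have he1 : e < 1 / 16 := by rw [he]; linarith
  have he' : e ≠ 0 := he0.ne'
  have hκe : κ = 1 - 16 * e := by rw [he]; ring
  have hθ' : θ ≠ 0 := hθ.ne'
  have ha0 : 0 < a := by rw [ha]; positivity
  have ha' : a ≠ 0 := ha0.ne'
  have ha1 : a ≤ 1 := by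
    rw [ha]
    have h1 : e ^ 10 ≤ 1 := pow_le_one₀ he0.le (by linarith)
    have h2 : θ ^ 2 ≤ 1 := by nlinarith
    nlinarith [pow_pos he0 10]
  have hU0 : 0 < U := by rw [hU]; positivity
  have haU : a * U = (1 + e) / e := by rw [hU]; field_simp
  have haU16 : 16 ≤ a * U := by
    rw [haU, le_div_iff₀ he0]; linarith
  have hU16 : 16 ≤ U := by nlinarith [mul_le_mul_of_nonneg_right ha1 hU0.le]
  have hdiv : 0 ≤ 21600 * U ^ 2 / e := by positivity
  have hM1 : 1 ≤ M := by rw [hM]; linarith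
  have hM0 : 0 ≤ M := by linarith
  have hMC : C + 1 ≤ M := by rw [hM]; linarith
  have hMU : 21600 * U ^ 2 ≤ e * M := by
    have : e * (21600 * U ^ 2 / e) = 21600 * U ^ 2 := by field_simp
    rw [hM]; nlinarith
  have ha2U : a ^ 2 * U = e ^ 9 * θ ^ 2 * (1 + e) := by
    have h1 : a ^ 2 * U = a * (a * U) := by ring
    rw [h1, haU, ha]; field_simp
  have h1eU : (1 + e) / U = e * a := by rw [hU]; field_simp
  have ha₂ : 0 < a * (1 - e) := mul_pos ha0 (by linarith)
  have ha₂' : a * (1 - e) ≤ a - (1 + e) / U := by rw [h1eU]; linarith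
  have hθU : θ ^ 2 * U = (1 + e) / e ^ 11 := by rw [hU, ha]; field_simp
  have hwin : (θ - e * θ) / U ≤ θ ^ 2 := by
    rw [div_le_iff₀ hU0, hθU]
    have h2 : 1 ≤ (1 + e) / e ^ 11 := by
      rw [le_div_iff₀ (by positivity)]
      nlinarith [pow_le_one₀ he0.le (show e ≤ 1 by linarith) (n := 11)]
    nlinarith
  have hbirth : (θ - e * θ) / U < a := by
    rw [div_lt_iff₀ hU0]
    nlinarith
  have htail : 2 * exp (-(3 * (e * θ) ^ 2) / (8 * a)) ≤ e := tail_le he0 he1 hθ ha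
  have htail1 : 2 * exp (-(3 * (e * θ) ^ 2) / (8 * a)) ≤ 1 := htail.trans (by linarith)
  have h2aU : 2 ≤ a * U := by linarith
  have h4aU : 4 ≤ a * U := by linarith
  -- the tested inequality at `z = (0,0)`, `r = 1`, `Q = Q₂(0,0)`
  have hstep := h (parabolicCylinderOpens 2 (0 : ℝ × EuclideanSpace ℝ (Fin 3))) (windJet M a U) (fun _ _ => 0)
    (windJet_suitable M h2aU) 0 1 one_pos (by rw [mul_one, coe_parabolicCylinderOpens])
  rw [mul_one] at hstep
  -- the CKN triple of the object
  have hlow := cknC_windJet_ge (U := U) hM0 hθ (by positivity : 0 ≤ e * θ) hU0 ha0 hwin hbirth htail1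
  have hupA := cknA_windJet_le hM0 ha0 ha1 hU0 h4aU
  have hupC := cknC_windJet_le hM0 ha0 ha1 hU0 h4aU he0 ha₂ ha₂'
  have hF1 := calc
    Literature.Claims.NS.Schatz2025.Ffun 1 0 (windJet M a U) (fun _ _ => 0)
        = cknA 1 0 (windJet M a U) + cknC 1 0 (windJet M a U) := by
      rw [Literature.Claims.NS.Schatz2025.Ffun, cknDOsc_zero_pressure, add_zero]
    _ ≤ _ := add_le_add hupA hupC
  have hFθ := hlow.trans
    (show cknC θ 0 (windJet M a U) ≤ Literature.Claims.NS.Schatz2025.Ffun θ 0 (windJet M a U)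
        (fun _ _ => 0) by
      rw [Literature.Claims.NS.Schatz2025.Ffun]; exact le_add_right (le_add_left le_rfl))
  have key := hFθ.trans (hstep.trans (add_le_add (mul_le_mul' le_rfl hF1) le_rfl))
  rw [← ENNReal.ofReal_add (by positivity) (by positivity), ← ENNReal.ofReal_mul hκ0.le,
    ← ENNReal.ofReal_add (by positivity) (by positivity),
    ENNReal.ofReal_le_ofReal_iff (by positivity)] at key
  exact absurd key (not_le.2 (main_real_ineq hκ0 hθ hθ8 hC he0 he1 hκe ha0 ha1 hU16 hM1 hMC hMU
    htail ha2U))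

end Summit.NavierStokesRegularity.NavierStokesRegularity.Theorems.Schatz2025
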